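import Literature.Probability.RandomPlanarGeometry.SwallowingProbCalculus
import Mathlib.Analysis.Normed.Group.Tannery
import HarnessLib

/-!
# Gauss's incomplete-beta identity `z^β ₂F₁(α, β; β+1; z) = β ∫₀ᶻ u^{β-1}(1-u)^{-α} du` and its endpoint `z = 1`

Topic `Probability/RandomPlanarGeometry`; theorems only. Deterministic special-function layer for
Rohde–Schramm's Lemma 6.6 (*Basic properties of SLE*, Ann. of Math. 161 (2005), eq. (6.13): the
law `P[X ≥ s] ∝ ₂F₁(1 - 4/κ, 2 - 8/κ; 2 - 4/κ; 1/s) s^{(4-κ)/κ}`, whose parameters have the shape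
`(β, α; β+1)` with `β = 1 - 4/κ`, `α = 2 - 8/κ`). `SwallowingProbCalculus` proves the case
`α = 1 - β` (`= 2a`, Lawler's (B.6)); here the first parameter is free:

* for `0 < α`, `0 < β` and `z ∈ [0, 1)`: **`z^β ₂F₁(α, β; β+1; z) = β ∫₀ᶻ u^{β-1}(1-u)^{-α} du`**
  (`rpow_mul_hypergeometric_eq_integral`; Beals–Wong (2016), §10.7 Exercise 4,
  `B_z(p, q) = (z^p/p) ₂F₁(p, 1-q; p+1; z)` with `p = β`, `q = 1 - α`, and the symmetry of `₂F₁` in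
  its first two parameters), by termwise differentiation of the Gauss series against the binomial
  series of `(1-z)^{-α}` (Mathlib `Real.one_div_one_sub_rpow_hasFPowerSeriesOnBall_zero`): both
  sides vanish at `0` and have derivative `β z^{β-1}(1-z)^{-α}` on `(0, 1)`;
* for `0 < α < 1`: the kernel is integrable up to `1`, the Gauss coefficients are summable (their
  partial sums are bounded by `β ∫₀¹`), and by Tannery's theorem (Abel's limit for non-negative
  coefficients) **`₂F₁(α, β; β+1; 1) = β ∫₀¹ u^{β-1}(1-u)^{-α} du = β Β(β, 1-α) =
  Γ(β+1)Γ(1-α)/Γ(β+1-α)`** (`hypergeometric_one_eq_integral`, `hypergeometric_one_eq_Gamma`: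
  Gauss's summation theorem `₂F₁(a,b;c;1) = Γ(c)Γ(c-a-b)/(Γ(c-a)Γ(c-b))` in the case `c = b + 1`, for
  Mathlib's `ordinaryHypergeometric`, whose value at the boundary point `1` is the `tsum` of the
  series).

## Mathlib

`ordinaryHypergeometric`, `ordinaryHypergeometricSeries_radius_eq_one` (through
`ordinaryHypergeometric_hasFPowerSeriesOnBall` of `CardyFunction`), `Ring.choose`, `ascPochhammer`,
`hasDerivAt_tsum_of_isPreconnected`, `constant_of_has_deriv_right_zero`,
`tendsto_tsum_of_dominated_convergence` (Tannery), `summable_of_sum_range_le`,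
`Complex.Gamma_mul_Gamma_eq_betaIntegral`. Mathlib has no Euler integral representation and no Gauss
summation theorem for `₂F₁` (searched `hypergeometric` + `integral`/`Gamma`).

## References

* S. Rohde, O. Schramm, *Basic properties of SLE*, Ann. of Math. 161 (2005), eq. (6.13).
* G. E. Andrews, R. Askey, R. Roy, *Special Functions*, CUP (1999), Thm 2.2.1 (Euler's integral),
  Thm 2.2.2 (Gauss's summation theorem), eq. (2.1.6).
* R. Beals, R. Wong, *Special Functions and Orthogonal Polynomials*, CUP (2016), §10.7, Exercise 4.
-/

open Set Filter Topology MeasureTheory Polynomial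
open scoped Nat

noncomputable section

namespace Literature.Probability.RandomPlanarGeometry

variable {α β : ℝ}

/-! ### The kernel `u^{β-1}(1-u)^{-α}` and its incomplete integral -/

/-- The kernel `u^{β-1}(1-u)^{-α}` is positive on `(0, 1)`. [folklore] -/
theorem betaKernel_pos (α β : ℝ) {u : ℝ} (hu : u ∈ Ioo (0 : ℝ) 1) :
    0 < u ^ (β - 1) * (1 - u) ^ (-α) :=
  mul_pos (Real.rpow_pos_of_pos hu.1 _) (Real.rpow_pos_of_pos (by linarith [hu.2]) _)

/-- The kernel is non-negative on `[0, 1]`. [folklore] -/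
theorem betaKernel_nonneg (α β : ℝ) {u : ℝ} (hu : u ∈ Icc (0 : ℝ) 1) :
    0 ≤ u ^ (β - 1) * (1 - u) ^ (-α) :=
  mul_nonneg (Real.rpow_nonneg hu.1 _) (Real.rpow_nonneg (by linarith [hu.2]) _)

/-- The kernel is continuous on `(0, 1)`. [folklore] -/
theorem continuousOn_betaKernel (α β : ℝ) :
    ContinuousOn (fun u : ℝ ↦ u ^ (β - 1) * (1 - u) ^ (-α)) (Ioo 0 1) := by
  intro u hu
  refine ContinuousAt.continuousWithinAt (ContinuousAt.mul ?_ ?_)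
  · exact Real.continuousAt_rpow_const _ _ (Or.inl hu.1.ne')
  · exact ContinuousAt.rpow_const (by fun_prop) (Or.inl (by linarith [hu.2] : (1 : ℝ) - u ≠ 0))

/-- **Integrability on `[0, z]`, `z < 1`, for `β > 0`**: `u^{β-1}` is integrable at `0`
(`β - 1 > -1`) and `(1-u)^{-α}` is continuous on `[0, z]`. [cite: AndrewsAskeyRoy1999, Def. 1.1.3] -/
theorem intervalIntegrable_betaKernel (α : ℝ) (hβ : 0 < β) {z : ℝ} (hz0 : 0 ≤ z) (hz : z < 1) :
    IntervalIntegrable (fun u : ℝ ↦ u ^ (β - 1) * (1 - u) ^ (-α)) volume 0 z := by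
  have h1 : IntervalIntegrable (fun u : ℝ ↦ u ^ (β - 1)) volume 0 z :=
    intervalIntegral.intervalIntegrable_rpow' (by linarith)
  have h2 : ContinuousOn (fun u : ℝ ↦ (1 - u) ^ (-α)) (uIcc 0 z) := by
    refine ContinuousOn.rpow_const (continuousOn_const.sub continuousOn_id) fun u hu ↦ Or.inl ?_
    rw [uIcc_of_le hz0] at hu
    have := hu.2
    intro h
    linarith
  exact h1.mul_continuousOn h2

/-- **Integrability on `[0, 1]` for `β > 0`, `α < 1`** (the beta integral `Β(β, 1-α)` converges):
on `[1/2, 1]` the factor `(1-u)^{-α}` is integrable (`-α > -1`) and `u^{β-1}` continuous.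
[cite: AndrewsAskeyRoy1999, Def. 1.1.3] -/
theorem intervalIntegrable_betaKernel_one (hα : α < 1) (hβ : 0 < β) :
    IntervalIntegrable (fun u : ℝ ↦ u ^ (β - 1) * (1 - u) ^ (-α)) volume 0 1 := by
  refine (intervalIntegrable_betaKernel α hβ (z := 1 / 2) (by norm_num) (by norm_num)).trans ?_
  -- on `[1/2, 1]`: substitute `u ↦ 1 - u`
  have h1 : IntervalIntegrable (fun u : ℝ ↦ u ^ (-α)) volume 0 (1 / 2) :=
    intervalIntegral.intervalIntegrable_rpow' (by linarith)
  have h2 : ContinuousOn (fun u : ℝ ↦ (1 - u) ^ (β - 1)) (uIcc 0 (1 / 2)) := by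
    refine ContinuousOn.rpow_const (continuousOn_const.sub continuousOn_id) fun u hu ↦ Or.inl ?_
    rw [uIcc_of_le (by norm_num : (0 : ℝ) ≤ 1 / 2)] at hu
    have := hu.2
    intro h
    linarith
  have h3 := (h1.continuousOn_mul h2).comp_sub_left 1
  simp only [sub_sub_cancel] at h3
  norm_num at h3
  exact h3.symm

/-- The kernel is integrable on every `[r, s] ⊆ [0, 1]` when `α < 1`, `β > 0`. [folklore] -/
theorem intervalIntegrable_betaKernel_of_mem (hα : α < 1) (hβ : 0 < β) {r s : ℝ}
    (hr : r ∈ Icc (0 : ℝ) 1) (hs : s ∈ Icc (0 : ℝ) 1) :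
    IntervalIntegrable (fun u : ℝ ↦ u ^ (β - 1) * (1 - u) ^ (-α)) volume r s :=
  (intervalIntegrable_betaKernel_one hα hβ).mono_set (by
    rw [uIcc_of_le zero_le_one]
    exact uIcc_subset_Icc hr hs)

/-- Fundamental theorem of calculus: `d/dz ∫₀ᶻ u^{β-1}(1-u)^{-α} du = z^{β-1}(1-z)^{-α}` on `(0, 1)`
(`β > 0`). [folklore] -/
theorem hasDerivAt_integral_betaKernel (α : ℝ) (hβ : 0 < β) {z : ℝ} (hz : z ∈ Ioo (0 : ℝ) 1) :
    HasDerivAt (fun w : ℝ ↦ ∫ u in (0 : ℝ)..w, u ^ (β - 1) * (1 - u) ^ (-α))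
      (z ^ (β - 1) * (1 - z) ^ (-α)) z := by
  have hcont := continuousOn_betaKernel α β
  refine intervalIntegral.integral_hasDerivAt_right
    (intervalIntegrable_betaKernel α hβ hz.1.le hz.2) ?_ ?_
  · exact hcont.stronglyMeasurableAtFilter isOpen_Ioo _ hz
  · exact hcont.continuousAt (isOpen_Ioo.mem_nhds hz)

/-- Continuity of `z ↦ ∫₀ᶻ u^{β-1}(1-u)^{-α} du` on `[0, z₁]` for `z₁ < 1` (`β > 0`). [folklore] -/
theorem continuousOn_integral_betaKernel (α : ℝ) (hβ : 0 < β) {z₁ : ℝ} (hz₁0 : 0 ≤ z₁) (hz₁ : z₁ < 1) :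
    ContinuousOn (fun w : ℝ ↦ ∫ u in (0 : ℝ)..w, u ^ (β - 1) * (1 - u) ^ (-α)) (Icc 0 z₁) := by
  have := intervalIntegral.continuousOn_primitive_interval' (intervalIntegrable_betaKernel α hβ hz₁0 hz₁)
    (a := 0) (by simp)
  rwa [uIcc_of_le hz₁0] at this

/-- Continuity of `z ↦ ∫₀ᶻ u^{β-1}(1-u)^{-α} du` on `[0, 1]` for `α < 1`, `β > 0`. [folklore] -/
theorem continuousOn_integral_betaKernel_one (hα : α < 1) (hβ : 0 < β) :
    ContinuousOn (fun w : ℝ ↦ ∫ u in (0 : ℝ)..w, u ^ (β - 1) * (1 - u) ^ (-α)) (Icc 0 1) := by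
  have := intervalIntegral.continuousOn_primitive_interval' (intervalIntegrable_betaKernel_one hα hβ)
    (a := 0) (by simp)
  rwa [uIcc_of_le zero_le_one] at this

/-! ### The Gauss series of `₂F₁(α, β; β+1; ·)` and the binomial series of `(1-z)^{-α}` -/

/-- For `0 < α`, `0 < β` the parameters `(α, β; β+1)` are not non-positive integers. [folklore] -/
theorem gauss_params_ne_neg_nat (hα : 0 < α) (hβ : 0 < β) (k : ℕ) :
    (k : ℝ) ≠ -α ∧ (k : ℝ) ≠ -β ∧ (k : ℝ) ≠ -(β + 1) := by
  have hk : (0 : ℝ) ≤ k := k.cast_nonneg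
  refine ⟨?_, ?_, ?_⟩ <;> intro h <;> linarith

/-- The Pochhammer identity `β (β+1)_n = (β)_n (β + n)`. [folklore] -/
theorem mul_ascPochhammer_add_one (β : ℝ) (n : ℕ) :
    β * (ascPochhammer ℝ n).eval (β + 1) = (ascPochhammer ℝ n).eval β * (β + n) := by
  have h := ascPochhammer_succ_eval n β
  rw [ascPochhammer_succ_left, eval_mul, eval_X, eval_comp, eval_add, eval_X, eval_one] at h
  exact h

/-- The coefficient identity `c_n (β + n) = β b_n`, `c_n = (α)_n (β)_n/((β+1)_n n!)`,
`b_n = (α)_n/n!`, behind `d/dz [z^β ₂F₁(α,β;β+1;z)] = β z^{β-1}(1-z)^{-α}`. [folklore] -/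
theorem gaussCoeff_mul (hβ : 0 < β) (n : ℕ) :
    (n ! : ℝ)⁻¹ * (ascPochhammer ℝ n).eval α * (ascPochhammer ℝ n).eval β *
        ((ascPochhammer ℝ n).eval (β + 1))⁻¹ * (β + n) =
      β * ((n ! : ℝ)⁻¹ * (ascPochhammer ℝ n).eval α) := by
  have hβ0 : (β : ℝ) ≠ 0 := hβ.ne'
  have h1 := (ascPochhammer_pos n (β + 1) (by linarith)).ne'
  have hn : (β + n : ℝ) ≠ 0 := by
    have : (0 : ℝ) ≤ n := n.cast_nonneg
    linarith
  have h' : (ascPochhammer ℝ n).eval (β + 1) = (ascPochhammer ℝ n).eval β * (β + n) / β := by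
    rw [eq_div_iff hβ0, mul_comm _ β]
    exact mul_ascPochhammer_add_one β n
  have h2 := (ascPochhammer_pos n β hβ).ne'
  rw [h']
  field_simp

/-- The binomial series `∑ (α)_n/n! · y^n = (1 - y)^{-α}` for `|y| < 1`
(Mathlib `Real.one_div_one_sub_rpow_hasFPowerSeriesOnBall_zero`). [cite: AndrewsAskeyRoy1999, eq. (2.1.6)] -/
theorem hasSum_binomCoeff (α : ℝ) {y : ℝ} (hy : |y| < 1) :
    HasSum (fun n ↦ (n ! : ℝ)⁻¹ * (ascPochhammer ℝ n).eval α * y ^ n) (1 / (1 - y) ^ α) := by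
  have hy' : ‖y‖₊ < 1 := by rw [← NNReal.coe_lt_coe, coe_nnnorm, Real.norm_eq_abs]; exact hy
  have h := (Real.one_div_one_sub_rpow_hasFPowerSeriesOnBall_zero α).hasSum (y := y)
    (by simpa [Metric.mem_eball, enorm_eq_nnnorm] using hy')
  simp only [zero_add, FormalMultilinearSeries.ofScalars_apply_eq, smul_eq_mul] at h
  have hc : ∀ n : ℕ, Ring.choose (α + n - 1) n = (n ! : ℝ)⁻¹ * (ascPochhammer ℝ n).eval α := by
    intro n
    rw [Ring.choose_eq_smul, descPochhammer_smeval_eq_ascPochhammer, ascPochhammer_smeval_eq_eval,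
      smul_eq_mul]
    congr 2
    ring
  simp only [hc] at h
  exact h

/-- The Gauss series `∑ c_n z^n = ₂F₁(α, β; β+1; z)` for `|z| < 1`, `0 < α`, `0 < β`.
[cite: AndrewsAskeyRoy1999, Def. 2.1.5] -/
theorem hasSum_gaussCoeff (hα : 0 < α) (hβ : 0 < β) {z : ℝ} (hz : |z| < 1) :
    HasSum (fun n ↦ (n ! : ℝ)⁻¹ * (ascPochhammer ℝ n).eval α * (ascPochhammer ℝ n).eval β *
        ((ascPochhammer ℝ n).eval (β + 1))⁻¹ * z ^ n) (₂F₁ α β (β + 1) z) := by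
  have hz' : ‖z‖₊ < 1 := by rw [← NNReal.coe_lt_coe, coe_nnnorm, Real.norm_eq_abs]; exact hz
  have h := (ordinaryHypergeometric_hasFPowerSeriesOnBall (𝔸 := ℝ) α β (β + 1)
    (gauss_params_ne_neg_nat hα hβ)).hasSum (y := z)
    (by simpa [Metric.mem_eball, enorm_eq_nnnorm] using hz')
  simp only [zero_add, ordinaryHypergeometricSeries_apply_eq, smul_eq_mul] at h
  exact h

/-- `₂F₁(α, β; β+1; ·)` is continuous on `(-1, 1)`. [cite: AndrewsAskeyRoy1999, Def. 2.1.5] -/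
theorem continuousOn_hypergeometric_gauss (hα : 0 < α) (hβ : 0 < β) :
    ContinuousOn (₂F₁ α β (β + 1) : ℝ → ℝ) (Ioo (-1) 1) := by
  have h := (ordinaryHypergeometric_hasFPowerSeriesOnBall (𝔸 := ℝ) α β (β + 1)
    (gauss_params_ne_neg_nat hα hβ)).continuousOn
  refine h.mono fun x hx ↦ ?_
  have : ‖x‖₊ < 1 := by
    rw [← NNReal.coe_lt_coe, coe_nnnorm, Real.norm_eq_abs]; exact abs_lt.2 hx
  simpa [Metric.mem_eball, enorm_eq_nnnorm] using this

/-- **Termwise differentiation of the Gauss series**: for `|z| < 1`, `0 < α`, `0 < β`,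
`F = ₂F₁(α, β; β+1; ·)` has a derivative `F'(z)` with `β F(z) + z F'(z) = β (1-z)^{-α}` — the series
identity `∑ (β+n) c_n z^n = β ∑ b_n z^n`. [cite: AndrewsAskeyRoy1999, Thm 2.2.1] -/
theorem exists_hasDerivAt_hypergeometric_gauss (hα : 0 < α) (hβ : 0 < β) {z : ℝ} (hz : |z| < 1) :
    ∃ D : ℝ, HasDerivAt (₂F₁ α β (β + 1) : ℝ → ℝ) D z ∧
      β * ₂F₁ α β (β + 1) z + z * D = β * (1 / (1 - z) ^ α) := by
  -- work on the ball of radius `ρ`, `|z| < ρ < 1`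
  obtain ⟨ρ, hzρ, hρ1⟩ := exists_between hz
  have hρ0 : 0 < ρ := (abs_nonneg z).trans_lt hzρ
  have hρ : |ρ| < 1 := by rwa [abs_of_pos hρ0]
  set c : ℕ → ℝ := fun n ↦ (n ! : ℝ)⁻¹ * (ascPochhammer ℝ n).eval α * (ascPochhammer ℝ n).eval β *
    ((ascPochhammer ℝ n).eval (β + 1))⁻¹ with hc
  set b : ℕ → ℝ := fun n ↦ (n ! : ℝ)⁻¹ * (ascPochhammer ℝ n).eval α with hb
  have hcnn : ∀ n, 0 ≤ c n := fun n ↦ by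
    have h1 := ascPochhammer_pos n α hα
    have h2 := ascPochhammer_pos n β hβ
    have h4 := ascPochhammer_pos n (β + 1) (by linarith)
    simp only [hc]
    positivity
  have hbnn : ∀ n, 0 ≤ b n := fun n ↦ by
    have h2 := ascPochhammer_pos n α hα
    simp only [hb]
    positivity
  have hcb : ∀ n : ℕ, c n * (β + n) = β * b n := fun n ↦ gaussCoeff_mul hβ n
  have hcle : ∀ n : ℕ, c n * n ≤ β * b n := fun n ↦ by
    rw [← hcb n]
    nlinarith [hcnn n, hβ]
  set g : ℕ → ℝ → ℝ := fun n s ↦ c n * s ^ n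
  set g' : ℕ → ℝ → ℝ := fun n s ↦ c n * n * s ^ (n - 1)
  set u : ℕ → ℝ := fun n ↦ β / ρ * (b n * ρ ^ n)
  have hu : Summable u := ((hasSum_binomCoeff α hρ).summable).mul_left _
  have hg : ∀ n s, s ∈ Ioo (-ρ) ρ → HasDerivAt (g n) (g' n s) s := by
    intro n s _
    have := (hasDerivAt_pow n s).const_mul (c n)
    simpa [g, g', mul_assoc] using this
  have hg' : ∀ n s, s ∈ Ioo (-ρ) ρ → ‖g' n s‖ ≤ u n := by
    intro n s hs
    have hs' : |s| ≤ ρ := (abs_lt.2 hs).le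
    simp only [g', u, Real.norm_eq_abs]
    rw [abs_mul, abs_of_nonneg (mul_nonneg (hcnn n) n.cast_nonneg), abs_pow]
    have h1 : c n * n * |s| ^ (n - 1) ≤ β * b n * ρ ^ (n - 1) :=
      mul_le_mul (hcle n) (pow_le_pow_left₀ (abs_nonneg s) hs' _)
        (by positivity) (mul_nonneg hβ.le (hbnn n))
    have h2 : β * b n * ρ ^ (n - 1) ≤ β / ρ * (b n * ρ ^ n) := by
      have hb' : 0 ≤ β * b n := mul_nonneg hβ.le (hbnn n)
      rcases Nat.eq_zero_or_pos n with hn | hn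
      · subst hn
        simp only [Nat.zero_sub, pow_zero, mul_one]
        rw [div_mul_eq_mul_div, le_div_iff₀ hρ0]
        exact mul_le_of_le_one_right hb' hρ1.le
      · rw [← Nat.sub_add_cancel hn, pow_succ, Nat.sub_add_cancel hn]
        field_simp
        rfl
    exact h1.trans h2
  have hg0 : Summable fun n ↦ g n 0 := by
    refine (summable_of_ne_finset_zero (s := {0}) fun n hn ↦ ?_)
    simp only [Finset.mem_singleton] at hn
    simp [g, hn]
  have hmem : z ∈ Ioo (-ρ) ρ := abs_lt.1 hzρ
  have h0mem : (0 : ℝ) ∈ Ioo (-ρ) ρ := by simpa using hρ0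
  have hD := hasDerivAt_tsum_of_isPreconnected hu isOpen_Ioo (convex_Ioo (-ρ) ρ).isPreconnected
    hg hg' h0mem hg0 hmem
  have hsg' : Summable fun n ↦ g' n z :=
    Summable.of_norm_bounded hu (fun n ↦ hg' n z hmem)
  refine ⟨∑' n, g' n z, ?_, ?_⟩
  · refine hD.congr_of_eventuallyEq ?_
    have : ∀ᶠ s in 𝓝 z, |s| < 1 := (isOpen_Iio.preimage continuous_abs).mem_nhds hz
    filter_upwards [this] with s hs
    exact ((hasSum_gaussCoeff hα hβ hs).tsum_eq).symm
  · have hF := hasSum_gaussCoeff hα hβ hz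
    have hF' : HasSum (fun n ↦ z * g' n z) (z * ∑' n, g' n z) := hsg'.hasSum.mul_left z
    have hsum := (hF.mul_left β).add hF'
    have hB := (hasSum_binomCoeff α hz).mul_left β
    have heq : (fun n ↦ β * (c n * z ^ n) + z * g' n z) = fun n ↦ β * (b n * z ^ n) := by
      ext n
      simp only [g']
      rw [mul_mul_pow_sub_one]
      calc β * (c n * z ^ n) + c n * n * z ^ n = (c n * (β + n)) * z ^ n := by ring
        _ = (β * b n) * z ^ n := by rw [hcb]
        _ = β * (b n * z ^ n) := by ring
    rw [heq] at hsum
    exact hsum.unique hB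

/-! ### The identity on `[0, 1)` -/

/-- On `(0, 1)`, `z ↦ z^β ₂F₁(α, β; β+1; z)` has derivative `β z^{β-1}(1-z)^{-α}` (`0 < α`, `0 < β`).
[cite: AndrewsAskeyRoy1999, Thm 2.2.1] -/
theorem hasDerivAt_rpow_mul_hypergeometric_gauss (hα : 0 < α) (hβ : 0 < β) {z : ℝ}
    (hz : z ∈ Ioo (0 : ℝ) 1) :
    HasDerivAt (fun s : ℝ ↦ s ^ β * ₂F₁ α β (β + 1) s)
      (β * (z ^ (β - 1) * (1 - z) ^ (-α))) z := by
  have hz' : |z| < 1 := abs_lt.2 ⟨by linarith [hz.1], hz.2⟩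
  have hz0 : z ≠ 0 := hz.1.ne'
  have hz1 : 0 ≤ 1 - z := by linarith [hz.2]
  obtain ⟨D, hD, hid⟩ := exists_hasDerivAt_hypergeometric_gauss hα hβ hz'
  have hpow : HasDerivAt (fun s : ℝ ↦ s ^ β) (β * z ^ (β - 1)) z :=
    Real.hasDerivAt_rpow_const (Or.inl hz0)
  have h := hpow.mul hD
  refine h.congr_deriv ?_
  have e2 : z ^ β = z ^ (β - 1) * z := by
    rw [show (β : ℝ) = (β - 1) + 1 by ring, Real.rpow_add_one hz0]
    ring_nf
  rw [e2, Real.rpow_neg hz1, ← one_div]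
  have : z ^ (β - 1) * (β * ₂F₁ α β (β + 1) z + z * D) =
      z ^ (β - 1) * (β * (1 / (1 - z) ^ α)) := by rw [hid]
  linarith [this]

/-- Continuity of `z ↦ z^β ₂F₁(α, β; β+1; z)` on `[0, 1)` (`0 < α`, `0 < β`). [folklore] -/
theorem continuousOn_rpow_mul_hypergeometric_gauss (hα : 0 < α) (hβ : 0 < β) :
    ContinuousOn (fun s : ℝ ↦ s ^ β * ₂F₁ α β (β + 1) s) (Ico 0 1) := by
  refine ContinuousOn.mul ?_ ((continuousOn_hypergeometric_gauss hα hβ).mono fun s hs ↦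
    ⟨by linarith [hs.1], hs.2⟩)
  exact fun s _ ↦ (Real.continuousAt_rpow_const s _ (Or.inr hβ.le)).continuousWithinAt

/-- **Gauss's incomplete-beta identity** (Beals–Wong (2016), §10.7 Exercise 4): for `0 < α`,
`0 < β` and `z ∈ [0, 1)`, `z^β ₂F₁(α, β; β+1; z) = β ∫₀ᶻ u^{β-1}(1-u)^{-α} du`. Both sides vanish at
`0`, are continuous on `[0, 1)` and have the same derivative on `(0, 1)`.
[cite: AndrewsAskeyRoy1999, Thm 2.2.1] -/
theorem rpow_mul_hypergeometric_eq_integral (hα : 0 < α) (hβ : 0 < β) {z : ℝ} (hz : z ∈ Ico (0 : ℝ) 1) :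
    z ^ β * ₂F₁ α β (β + 1) z = β * ∫ u in (0 : ℝ)..z, u ^ (β - 1) * (1 - u) ^ (-α) := by
  set K : ℝ → ℝ := fun s ↦ s ^ β * ₂F₁ α β (β + 1) s -
    β * ∫ u in (0 : ℝ)..s, u ^ (β - 1) * (1 - u) ^ (-α) with hK
  have hK0 : K 0 = 0 := by simp [hK, Real.zero_rpow hβ.ne']
  suffices K z = 0 by simpa [hK, sub_eq_zero] using this
  rcases hz.1.eq_or_lt with h0 | h0
  · rw [← h0]; exact hK0
  have hderiv : ∀ x ∈ Ioo (0 : ℝ) 1, HasDerivAt K 0 x := by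
    intro x hx
    have h1 := hasDerivAt_rpow_mul_hypergeometric_gauss hα hβ hx
    have h2 := (hasDerivAt_integral_betaKernel α hβ hx).const_mul β
    have h3 := h1.sub h2
    rwa [sub_self] at h3
  have hKcont : ContinuousOn K (Icc 0 z) := by
    refine ContinuousOn.sub ((continuousOn_rpow_mul_hypergeometric_gauss hα hβ).mono ?_)
      (continuousOn_const.mul (continuousOn_integral_betaKernel α hβ hz.1 hz.2))
    exact fun s hs ↦ ⟨hs.1, hs.2.trans_lt hz.2⟩
  have hconst : ∀ s ∈ Ioo (0 : ℝ) z, K s = K z := by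
    intro s hs
    have h := constant_of_has_deriv_right_zero (f := K) (a := s) (b := z)
      (hKcont.mono fun x hx ↦ ⟨hs.1.le.trans hx.1, hx.2⟩) ?_ z ⟨hs.2.le, le_rfl⟩
    · exact h.symm
    · intro x hx
      exact (hderiv x ⟨hs.1.trans_le hx.1, hx.2.trans hz.2⟩).hasDerivWithinAt
  haveI : (𝓝[Ioo (0 : ℝ) z] 0).NeBot := by
    rw [← mem_closure_iff_nhdsWithin_neBot, closure_Ioo h0.ne]
    exact ⟨le_rfl, h0.le⟩
  have h1 : Tendsto K (𝓝[Ioo (0 : ℝ) z] 0) (𝓝 (K 0)) :=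
    (hKcont 0 ⟨le_rfl, h0.le⟩).tendsto.mono_left (nhdsWithin_mono _ Ioo_subset_Icc_self)
  have h2 : Tendsto K (𝓝[Ioo (0 : ℝ) z] 0) (𝓝 (K z)) :=
    tendsto_const_nhds.congr' (eventually_mem_nhdsWithin.mono fun s hs ↦ (hconst s hs).symm)
  rw [tendsto_nhds_unique h2 h1, hK0]

/-! ### The endpoint `z = 1` for `α < 1`: Gauss's summation theorem in the case `c = b + 1` -/

/-- **The Gauss coefficients are summable when `α < 1`** (`0 < α`, `0 < β`): their partial sums
`∑_{n<N} c_n = lim_{z↑1} ∑_{n<N} c_n z^n ≤ lim sup_{z↑1} z^{-β} β ∫₀ᶻ ≤ β ∫₀¹ u^{β-1}(1-u)^{-α} du`.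
[cite: AndrewsAskeyRoy1999, Thm 2.2.2] -/
theorem summable_gaussCoeff (hα : 0 < α) (hα1 : α < 1) (hβ : 0 < β) :
    Summable fun n ↦ (n ! : ℝ)⁻¹ * (ascPochhammer ℝ n).eval α * (ascPochhammer ℝ n).eval β *
      ((ascPochhammer ℝ n).eval (β + 1))⁻¹ := by
  set c : ℕ → ℝ := fun n ↦ (n ! : ℝ)⁻¹ * (ascPochhammer ℝ n).eval α * (ascPochhammer ℝ n).eval β *
    ((ascPochhammer ℝ n).eval (β + 1))⁻¹ with hc
  have hcnn : ∀ n, 0 ≤ c n := fun n ↦ by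
    have h1 := ascPochhammer_pos n α hα
    have h2 := ascPochhammer_pos n β hβ
    have h4 := ascPochhammer_pos n (β + 1) (by linarith)
    simp only [hc]
    positivity
  set B : ℝ := ∫ u in (0 : ℝ)..1, u ^ (β - 1) * (1 - u) ^ (-α) with hB
  -- for `z ∈ (0, 1)`: `∑_{n<N} c_n z^n ≤ F(z) = z^{-β} β ∫₀ᶻ ≤ z^{-β} β B`
  have hpartial : ∀ (N : ℕ) {z : ℝ}, z ∈ Ioo (0 : ℝ) 1 →
      ∑ n ∈ Finset.range N, c n * z ^ n ≤ z ^ (-β) * (β * B) := by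
    intro N z hz
    have hz' : |z| < 1 := abs_lt.2 ⟨by linarith [hz.1], hz.2⟩
    have hsum := hasSum_gaussCoeff hα hβ hz'
    have h1 : ∑ n ∈ Finset.range N, c n * z ^ n ≤ ₂F₁ α β (β + 1) z :=
      sum_le_hasSum (Finset.range N) (fun n _ ↦ mul_nonneg (hcnn n) (pow_nonneg hz.1.le n)) hsum
    have h2 : ₂F₁ α β (β + 1) z = z ^ (-β) * (β * ∫ u in (0 : ℝ)..z, u ^ (β - 1) * (1 - u) ^ (-α)) := by
      rw [← rpow_mul_hypergeometric_eq_integral hα hβ ⟨hz.1.le, hz.2⟩, ← mul_assoc,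
        Real.rpow_neg hz.1.le, inv_mul_cancel₀ (Real.rpow_pos_of_pos hz.1 β).ne', one_mul]
    have h3 : ∫ u in (0 : ℝ)..z, u ^ (β - 1) * (1 - u) ^ (-α) ≤ B :=
      intervalIntegral.integral_mono_interval le_rfl hz.1.le hz.2.le
        ((ae_restrict_iff' measurableSet_Ioc).2 (ae_of_all _ fun u hu ↦
          betaKernel_nonneg α β ⟨hu.1.le, hu.2⟩))
        (intervalIntegrable_betaKernel_one hα1 hβ)
    rw [h2] at h1
    exact h1.trans (mul_le_mul_of_nonneg_left (mul_le_mul_of_nonneg_left h3 hβ.le)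
      (Real.rpow_nonneg hz.1.le _))
  -- pass to the limit `z → 1⁻`
  have hle : ∀ N : ℕ, ∑ n ∈ Finset.range N, c n ≤ β * B := by
    intro N
    have hcont : ContinuousAt (fun z : ℝ ↦ z ^ (-β) * (β * B) - ∑ n ∈ Finset.range N, c n * z ^ n) 1 := by
      refine (ContinuousAt.mul (Real.continuousAt_rpow_const 1 _ (Or.inl one_ne_zero))
        continuousAt_const).sub ?_
      exact (continuous_finsetSum _ fun n _ ↦ (continuous_const.mul (continuous_pow n))).continuousAt
    have hev : ∀ᶠ z in 𝓝[<] (1 : ℝ), 0 ≤ z ^ (-β) * (β * B) - ∑ n ∈ Finset.range N, c n * z ^ n := by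
      have hmem : Ioo (0 : ℝ) 1 ∈ 𝓝[<] (1 : ℝ) := Ioo_mem_nhdsLT one_pos
      filter_upwards [hmem] with z hz
      linarith [hpartial N hz]
    haveI : (𝓝[<] (1 : ℝ)).NeBot := nhdsLT_neBot 1
    have h := ge_of_tendsto (hcont.tendsto.mono_left nhdsWithin_le_nhds) hev
    simp only [Real.one_rpow, one_mul, one_pow, mul_one] at h
    linarith
  exact summable_of_sum_range_le hcnn hle

/-- **`₂F₁(α, β; β+1; 1) = β ∫₀¹ u^{β-1}(1-u)^{-α} du` for `0 < α < 1`, `0 < β`.** Mathlib's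
`ordinaryHypergeometric` at the boundary point `1` is the sum of the (summable,
`summable_gaussCoeff`) Gauss series; by Tannery's theorem `∑ c_n z^n → ∑ c_n` as `z ↑ 1`, while
`z^{-β} β ∫₀ᶻ → β ∫₀¹` (`rpow_mul_hypergeometric_eq_integral` on `[0, 1)`).
[cite: AndrewsAskeyRoy1999, Thm 2.2.2] -/
theorem hypergeometric_one_eq_integral (hα : 0 < α) (hα1 : α < 1) (hβ : 0 < β) :
    ₂F₁ α β (β + 1) (1 : ℝ) = β * ∫ u in (0 : ℝ)..1, u ^ (β - 1) * (1 - u) ^ (-α) := by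
  set c : ℕ → ℝ := fun n ↦ (n ! : ℝ)⁻¹ * (ascPochhammer ℝ n).eval α * (ascPochhammer ℝ n).eval β *
    ((ascPochhammer ℝ n).eval (β + 1))⁻¹ with hc
  have hcnn : ∀ n, 0 ≤ c n := fun n ↦ by
    have h1 := ascPochhammer_pos n α hα
    have h2 := ascPochhammer_pos n β hβ
    have h4 := ascPochhammer_pos n (β + 1) (by linarith)
    simp only [hc]
    positivity
  have hcs : Summable c := summable_gaussCoeff hα hα1 hβ
  -- the value at `1` is the sum of the series
  have hF1 : ₂F₁ α β (β + 1) (1 : ℝ) = ∑' n, c n := by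
    rw [ordinaryHypergeometric, ordinaryHypergeometric_sum_eq]
    simp only [smul_eq_mul, one_pow, mul_one]
    rfl
  -- Tannery: `∑ c_n z^n → ∑ c_n` as `z → 1⁻`
  have hT : Tendsto (fun z : ℝ ↦ ∑' n, c n * z ^ n) (𝓝[<] 1) (𝓝 (∑' n, c n)) := by
    have h := tendsto_tsum_of_dominated_convergence (𝓕 := 𝓝[<] (1 : ℝ)) (f := fun z n ↦ c n * z ^ n)
      (g := c) (bound := c) hcs (fun n ↦ ?_) ?_
    · exact h
    · have : Tendsto (fun z : ℝ ↦ c n * z ^ n) (𝓝 1) (𝓝 (c n * 1 ^ n)) :=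
        ((continuous_const.mul (continuous_pow n)).tendsto 1)
      rw [one_pow, mul_one] at this
      exact this.mono_left nhdsWithin_le_nhds
    · have hmem : Ioo (0 : ℝ) 1 ∈ 𝓝[<] (1 : ℝ) := Ioo_mem_nhdsLT one_pos
      filter_upwards [hmem] with z hz n
      rw [Real.norm_eq_abs, abs_mul, abs_of_nonneg (hcnn n), abs_pow, abs_of_nonneg hz.1.le]
      exact mul_le_of_le_one_right (hcnn n) (pow_le_one₀ hz.1.le hz.2.le)
  -- the same function is `z^{-β} β ∫₀ᶻ` on `(0, 1)`, which tends to `β ∫₀¹`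
  have hI : Tendsto (fun z : ℝ ↦ z ^ (-β) * (β * ∫ u in (0 : ℝ)..z, u ^ (β - 1) * (1 - u) ^ (-α)))
      (𝓝[<] 1) (𝓝 ((1 : ℝ) ^ (-β) * (β * ∫ u in (0 : ℝ)..1, u ^ (β - 1) * (1 - u) ^ (-α)))) := by
    refine Tendsto.mul ?_ (Tendsto.const_mul β ?_)
    · exact ((Real.continuousAt_rpow_const 1 _ (Or.inl one_ne_zero)).tendsto).mono_left
        nhdsWithin_le_nhds
    · have h := (continuousOn_integral_betaKernel_one hα1 hβ) 1 ⟨zero_le_one, le_rfl⟩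
      exact h.tendsto.mono_left (nhdsWithin_le_iff.2
        (mem_of_superset (Ioo_mem_nhdsLT one_pos) Ioo_subset_Icc_self))
  rw [Real.one_rpow, one_mul] at hI
  have heq : (fun z : ℝ ↦ ∑' n, c n * z ^ n) =ᶠ[𝓝[<] 1]
      fun z : ℝ ↦ z ^ (-β) * (β * ∫ u in (0 : ℝ)..z, u ^ (β - 1) * (1 - u) ^ (-α)) := by
    have hmem : Ioo (0 : ℝ) 1 ∈ 𝓝[<] (1 : ℝ) := Ioo_mem_nhdsLT one_pos
    filter_upwards [hmem] with z hz
    have hz' : |z| < 1 := abs_lt.2 ⟨by linarith [hz.1], hz.2⟩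
    rw [(hasSum_gaussCoeff hα hβ hz').tsum_eq, ← rpow_mul_hypergeometric_eq_integral hα hβ ⟨hz.1.le, hz.2⟩,
      ← mul_assoc, Real.rpow_neg hz.1.le, inv_mul_cancel₀ (Real.rpow_pos_of_pos hz.1 β).ne', one_mul]
  haveI : (𝓝[<] (1 : ℝ)).NeBot := nhdsLT_neBot 1
  rw [hF1]
  exact tendsto_nhds_unique hT (hI.congr' heq.symm)

/-! ### Euler's beta integral: `∫₀¹ u^{β-1}(1-u)^{-α} du = Γ(β)Γ(1-α)/Γ(β+1-α)` -/

/-- Mathlib's complex beta integral `Β(β, 1-α)` is the real number `∫₀¹ u^{β-1}(1-u)^{-α} du`.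
[cite: AndrewsAskeyRoy1999, Def. 1.1.3] -/
theorem betaIntegral_eq_integral_betaKernel (α β : ℝ) :
    Complex.betaIntegral (β : ℂ) ((1 - α : ℝ) : ℂ) =
      ((∫ u in (0 : ℝ)..1, u ^ (β - 1) * (1 - u) ^ (-α) : ℝ) : ℂ) := by
  rw [Complex.betaIntegral, ← intervalIntegral.integral_ofReal]
  refine intervalIntegral.integral_congr_ae ?_
  refine Filter.Eventually.of_forall fun x hx ↦ ?_
  rw [uIoc_of_le zero_le_one] at hx
  have hx0 : 0 ≤ x := hx.1.le
  have hx1 : 0 ≤ 1 - x := by linarith [hx.2]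
  have e1 : (β : ℂ) - 1 = ((β - 1 : ℝ) : ℂ) := by push_cast; ring
  have e2 : ((1 - α : ℝ) : ℂ) - 1 = ((-α : ℝ) : ℂ) := by push_cast; ring
  rw [e1, e2, ← Complex.ofReal_one, ← Complex.ofReal_sub, ← Complex.ofReal_cpow hx0,
    ← Complex.ofReal_cpow hx1, ← Complex.ofReal_mul]

/-- **Euler's beta integral** `∫₀¹ u^{β-1}(1-u)^{-α} du = Γ(β)Γ(1-α)/Γ(β+1-α)` for `0 < β`, `α < 1`
(Andrews–Askey–Roy (1999), Thm 1.1.4; Mathlib `Complex.Gamma_mul_Gamma_eq_betaIntegral`).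
[cite: AndrewsAskeyRoy1999, Thm 1.1.4] -/
theorem integral_betaKernel_eq_Gamma (hα1 : α < 1) (hβ : 0 < β) :
    ∫ u in (0 : ℝ)..1, u ^ (β - 1) * (1 - u) ^ (-α) =
      Real.Gamma β * Real.Gamma (1 - α) / Real.Gamma (β + 1 - α) := by
  have hpos : 0 < 1 - α := by linarith
  have h := Complex.Gamma_mul_Gamma_eq_betaIntegral (s := (β : ℂ)) (t := ((1 - α : ℝ) : ℂ))
    (by simpa using hβ) (by simpa using hpos)
  rw [betaIntegral_eq_integral_betaKernel, ← Complex.ofReal_add, Complex.Gamma_ofReal,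
    Complex.Gamma_ofReal, Complex.Gamma_ofReal] at h
  have h' : Real.Gamma β * Real.Gamma (1 - α) =
      Real.Gamma (β + (1 - α)) * ∫ u in (0 : ℝ)..1, u ^ (β - 1) * (1 - u) ^ (-α) := by
    exact_mod_cast h
  have e : β + (1 - α) = β + 1 - α := by ring
  rw [e] at h'
  have hG : Real.Gamma (β + 1 - α) ≠ 0 := (Real.Gamma_pos_of_pos (by linarith)).ne'
  rw [eq_div_iff hG, h', mul_comm]

/-- **Gauss's summation theorem for `c = b + 1`**: for `0 < α < 1`, `0 < β`,
`₂F₁(α, β; β+1; 1) = Γ(β+1)Γ(1-α)/Γ(β+1-α)` (`= Γ(c)Γ(c-a-b)/(Γ(c-a)Γ(c-b))` with `c = β+1`,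
`Γ(c-b) = Γ(1) = 1`). [cite: AndrewsAskeyRoy1999, Thm 2.2.2] -/
theorem hypergeometric_one_eq_Gamma (hα : 0 < α) (hα1 : α < 1) (hβ : 0 < β) :
    ₂F₁ α β (β + 1) (1 : ℝ) = Real.Gamma (β + 1) * Real.Gamma (1 - α) / Real.Gamma (β + 1 - α) := by
  rw [hypergeometric_one_eq_integral hα hα1 hβ, integral_betaKernel_eq_Gamma hα1 hβ,
    Real.Gamma_add_one hβ.ne']
  ring

end Literature.Probability.RandomPlanarGeometry
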